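import Mathlib
import HarnessLib
import Summits.HubbardSuperconductivity.HubbardSuperconductivity.Theorems.ComplexGFFStiffnessHypALocalTwoPointFreeEnergySubSizes
import Summits.HubbardSuperconductivity.HubbardSuperconductivity.Theorems.ComplexGFFStiffnessHypALocalTwoPointFreeEnergySub
import Literature.Dynamics.Hyperbolic.RGFlowStableManifoldFreeEnergyConstants

/-!
# Crux `HypALocalTwoPoint`, line `gnv` — the first-difference clause of `FreeEnergyBounds` at fixed
# `(L, N)` with an `N`-FREE CONSTANT `C₂ · |Λ| · u` (census F1 (iii)+(iv) at fixed volume)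

Route `route-HubbardSuperconductivity-ComplexGFFStiffness`, crux item stmt-HubbardSuperconductivity-19155,
registered stub `stub_twoPointGivenZ` (⇐ `FreeEnergyBounds`, p817758).  Two-system twin of
`…FreeEnergyClause3`: composition of `…FreeEnergySubSizes.freeEnergySubSizes_of_package`,
`…FreeEnergySub.norm_freeEnergy_sub_le_of_sizes` and `RGFlow.freeEnergy_sub_bound_le`:

* **`norm_freeEnergy_sub_le_of_package`** — `‖f(𝒦+U) − f(𝒦)‖ ≤ C₂ · |Λ| · u₁`, `C₂` explicit in the
  `L`-level data and the first-order F4 constants — the second clause of `FreeEnergyBounds` at this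
  `(L, N)`; what remains of census F1 is the quantifier assembly over `(L, N)`.
Honest scope: conditional on F4 (hypotheses); no `sorry`, no new named fact.

## References
* S. Adams, S. Buchholz, R. Kotecký, S. Müller, arXiv:1910.13564, Thm 2.2 [AdamsBuchholzKoteckyMuller2019].
-/






noncomputable section

-- `Summit.<Summit>.<Problem>`: single-conjunct summit, the duplicate component is mandated (D-0017).
set_option linter.dupNamespace false

namespace Summit.HubbardSuperconductivity.HubbardSuperconductivity.Theorems.ComplexGFF

open scoped BigOperators ComplexConjugate
open Real Set Finset MeasureTheory
open Literature.MathematicalPhysics.StatisticalMechanics.GradientRG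
open Literature.MathematicalPhysics.StatisticalMechanics.GradientFRD
  (fourierCoeff cExt cExt_of_mem IsElliptic IsUnitSymm InShell iterDiff supNorm conv ellOp isElliptic_one)
open Literature.MathematicalPhysics.StatisticalMechanics.TorusPolymer
  (IsPolymer numBlocks blockOf boxCorner isPolymer_blockOf isConn_blockOf pcirc)
open Literature.Barriers.CriticalPhenomena.LongRangePhi4.Polymer (IsConn components)
open Literature.MathematicalPhysics.QuantumFieldTheory
open Literature.Dynamics.Hyperbolic

variable {d M : ℕ} [NeZero M]

section Package

variable {L N Mord R n ñ : ℕ} {θbar lam μ δ₁ δ₀ A𝒫 : ℝ}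
    {𝒞 : Matrix (Fin d) (Fin d) ℝ → ℕ → (Fin d → ZMod M) → ℝ} {Mc : ℕ → ℝ}
    {Cα : (Fin d → ℕ) → ℕ → ℝ} {c C : ℝ} {Cℓ : ℕ → ℝ}

set_option maxHeartbeats 3200000 in
/-- **The first-difference clause of `FreeEnergyBounds` at fixed `(L, N)` with an `N`-free constant**
([ABKM19] Theorem 2.2, `ℓ = 1`, difference form, `ι`-symmetric complex class; census F1 (iii)+(iv) at fixed
volume): in the setting of `freeEnergySubSizes_of_package` (package, tuned seeds of the systems `𝒦 + U`
and `𝒦`, the first-order `q`-regularity hypotheses F4 and the smallness),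
`‖f(𝒦+U) − f(𝒦)‖ ≤ C₂ · |Λ| · u₁` with the displayed `C₂` depending on `L`-level data only:
composition of `freeEnergySubSizes_of_package`, `norm_freeEnergy_sub_le_of_sizes` and
`RGFlow.freeEnergy_sub_bound_le`. -/
theorem norm_freeEnergy_sub_le_of_package {h : ℝ} [Fact (0 < h)] [Fact (0 < L)]
    (hd : 3 ≤ d) (hMord : 1 ≤ Mord) (hMR : Mord ≤ R) (hLodd : Odd L) (hL : 2 ^ (d + 3) + 16 * R ≤ L)
    (hR2 : 2 ≤ R) (hM : M = L ^ N)
    (hθbar : 0 < θbar) (hlam : 0 < lam) (hn : 2 * Mord ≤ n) (hn2 : 2 ≤ n) (hnñ : n ≤ ñ)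
    (hc : 0 < c) (hC1 : 0 ≤ Cℓ 1)
    (hallA : ∀ A : Matrix (Fin d) (Fin d) ℝ, IsElliptic (1 / 2 : ℝ) 2 A →
        (∀ k, 1 ≤ k → k ≤ N + 1 →
          ∑ x : Fin d → ZMod M, 𝒞 A k x = 0 ∧ ∀ x, 𝒞 A k (-x) = 𝒞 A k x) ∧
        (∀ k, 1 ≤ k → k ≤ N + 1 → ∀ φ : (Fin d → ZMod M) → ℝ, ∑ x, φ x = 0 →
          0 ≤ ∑ x, ∑ y, φ x * 𝒞 A k (x - y) * φ y) ∧
        (∀ φ : (Fin d → ZMod M) → ℝ, ∑ x, φ x = 0 →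
          ellOp A (conv (fun x => ∑ k ∈ Finset.Icc 1 (N + 1), 𝒞 A k x) φ) = φ) ∧
        (∀ k, 1 ≤ k → k ≤ N → Mc k ≤ 0 ∧
          ∀ x : Fin d → ZMod M, ((L : ℝ) ^ k) / 2 ≤ (supNorm x : ℝ) →
            𝒞 A k x = Mc k) ∧
        (∀ k, 1 ≤ k → k ≤ N + 1 → ∀ B : Matrix (Fin d) (Fin d) ℝ, IsUnitSymm B →
          (∃ ε : ℝ, 0 < ε ∧ ∀ x : Fin d → ZMod M,
            ContDiffOn ℝ ⊤ (fun s : ℝ => 𝒞 (A + s • B) k x) (Set.Ioo (-ε) ε)) ∧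
          ∀ α : Fin d → ℕ, ∑ i, α i ≤ n → ∀ ℓ : ℕ, ∀ x : Fin d → ZMod M,
            abs (iteratedDeriv ℓ (fun s : ℝ => iterDiff α (𝒞 (A + s • B) k) x) 0)
              ≤ Cα α ℓ / (L : ℝ) ^ ((k - 1) * (d - 2 + ∑ i, α i))) ∧
        (∀ k, 1 ≤ k → k ≤ N + 1 → ∀ j : ℕ, ∀ κ : Fin d → ZMod M, κ ≠ 0 → InShell L j κ →
          (j < k →
            c / (L : ℝ) ^ (2 * (d + ñ) + 1) * (L : ℝ) ^ (2 * j)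
                / (L : ℝ) ^ ((k - j) * (d - 1 + n)) ≤ (fourierCoeff (𝒞 A k) κ).re ∧
            ‖fourierCoeff (𝒞 A k) κ‖
              ≤ C * (L : ℝ) ^ (2 * (d + ñ) + 1) * (L : ℝ) ^ (2 * j)
                  / (L : ℝ) ^ ((k - j) * (d - 1 + n))) ∧
          (k ≤ j →
            c / (L : ℝ) ^ (2 * (d + ñ) + 1) * (L : ℝ) ^ (2 * k)
                ≤ (fourierCoeff (𝒞 A k) κ).re ∧
            ‖fourierCoeff (𝒞 A k) κ‖ ≤ C * (L : ℝ) ^ (2 * k)) ∧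
          ∀ B : Matrix (Fin d) (Fin d) ℝ, IsUnitSymm B → ∀ ℓ : ℕ, 1 ≤ ℓ →
            (j < k →
              ‖iteratedDeriv ℓ (fun s : ℝ => fourierCoeff (𝒞 (A + s • B) k) κ) 0‖
                ≤ Cℓ ℓ * (L : ℝ) ^ (2 * (d + ñ) + 1) * (L : ℝ) ^ (2 * j)
                    / (L : ℝ) ^ ((k - j) * (d - 1 + ñ))) ∧
            (k ≤ j →
              ‖iteratedDeriv ℓ (fun s : ℝ => fourierCoeff (𝒞 (A + s • B) k) κ) 0‖
                ≤ Cℓ ℓ * (L : ℝ) ^ (2 * k))))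
    (hB : AbkmWeightBounds L N Mord R n θbar lam μ δ₁ δ₀ A𝒫 (fun j => 𝒞 1 j)
      (abkmWeightData L N Mord R θbar (schedDelta δ₀ δ₁ N) fun j => 𝒞 1 j))
    {pT r₀ : ℕ} (hp : d / 2 + 2 ≤ pT) (hpM : pT + d ≤ Mord) (hr₀ : 3 ≤ r₀)
    (hδ₀ : 0 < δ₀) (hδ₁ : 0 < δ₁) (hh0 : hZeroSq d R δ₀ δ₁ ≤ h ^ 2)
    (hh2 : secondDiffConst (fun θ' => Cα θ' 0) ≤ h ^ 2)
    -- the tuning ball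
    {θ : ℝ} (hθ0 : 0 ≤ θ) (hθ : θ < θbar)
    {T₀ : ℝ} (hT₀ : T₀ ≤ 1 / 2) (hKT₀ : shellRatioConst c (Cℓ 1) (L : ℝ) d ñ * T₀ ≤ Real.log (1 + θ))
    {A𝒫' : ℝ} (hA𝒫' : weightIntConstRho θbar θ (traceConst d Mord R lam (derivSum d n fun θ' _ => Cα θ' 0)) = A𝒫')
    -- the side conditions of Theorem 6.8 (`RGStepABKMQ`), at `A_𝒫' = A_𝒫(θ)`
    {A : ℝ} (hA1 : 1 ≤ A) (hA𝒫A : A𝒫' ≤ A)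
    (hsmall : (2 : ℝ) ^ (L ^ d) * (A𝒫' * A ^ (-(1 - (1 + 1 / ((2 * (2 ^ d + 1) + 6 : ℝ) ^ d))⁻¹) : ℝ)) ≤ 1)
    {r : ℝ} (hr0 : 0 ≤ r) (hr : r ≤ 1 / 64)
    (hv : vABKM d R A A𝒫' r ≤ 1 / 64) (hωA : omegaABKM d R A A𝒫' r * A ^ 2 ≤ 1)
    (hc3A : (kappaABKM d R A A𝒫' r) ^ (L ^ d) * ((2 * (2 * (kappaABKM d R A A𝒫' r) * max 1 A𝒫')) ^ ((2 ^ (d + 1) + 2) ^ d * L ^ d) * (4 : ℝ) ^ ((2 ^ (d + 1) + 2) ^ d * L ^ d)) ≤ A ^ ((1 + 1 / ((2 * (2 ^ d + 1) + 6 : ℝ) ^ d)) - 1 : ℝ))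
    (hc2A : (kappaABKM d R A A𝒫' r) ^ (L ^ d) * ((2 * (kappaABKM d R A A𝒫' r) * max 1 A𝒫') ^ ((2 ^ (d + 1) + 2) ^ d * L ^ d) * (2 : ℝ) ^ ((2 ^ (d + 1) + 2) ^ d * L ^ d)) ≤ A ^ ((1 + 1 / ((2 * (2 ^ d + 1) + 6 : ℝ) ^ d)) - 1 : ℝ))
    -- the contraction regime of Ch. 12
    {η κ ε ρ : ℝ} (hη : 0 < η) (hη1 : η ≤ 1)
    (hκ₁ : (3 / 4 : ℝ) * (η + (L : ℝ) ^ d * (pi2BoundConst d (((2 * R + 2 : ℕ) : ℝ) + ((d / 2 + 1 : ℕ) : ℝ)) * (A𝒫' * A⁻¹))) ≤ κ)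
    (hκ₂ : sigmaABKM d L R A A𝒫' r ≤ κ * η) (hκ : κ < 1)
    (hε : 0 ≤ ε) (hεr : ε ≤ r) (hερ : ε ≤ ρ) (hρ16 : ρ ≤ 1 / 16)

    (hqT₀ : 2 * (d : ℝ) ^ 2 / (((L ^ (d * 0) : ℕ) : ℝ) * (fieldWt h (L : ℝ) d 0 / (L : ℝ) ^ 0) ^ 2) * ρ ≤ T₀)
    -- the perturbation and its increment
    {𝒦 U : (Fin d → ℝ) → ℂ} {ρ𝒦 u₁ : ℝ} (h𝒦 : ContDiff ℝ r₀ 𝒦) (hU : ContDiff ℝ r₀ U)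
    (h𝒦b : ∀ s, s ≤ r₀ → ∀ z : Fin d → ℝ, ‖iteratedFDeriv ℝ s 𝒦 z‖ ≤ ρ𝒦 * Real.exp ((∑ i, z i ^ 2) / 4))
    (h𝒦Ub : ∀ s, s ≤ r₀ → ∀ z : Fin d → ℝ,
      ‖iteratedFDeriv ℝ s (fun z => 𝒦 z + U z) z‖ ≤ ρ𝒦 * Real.exp ((∑ i, z i ^ 2) / 4))
    (hUb : ∀ s, s ≤ r₀ → ∀ z : Fin d → ℝ, ‖iteratedFDeriv ℝ s U z‖ ≤ u₁ * Real.exp ((∑ i, z i ^ 2) / 4))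
    (hu₁ : 0 ≤ u₁)
    (h𝒦small : (Real.exp (1 / 4) + 2 * Real.exp (3 / 8)) * (ρ𝒦 * Real.exp (fieldWt h (L : ℝ) d 0 / (L : ℝ) ^ 0)) * A ≤ 1 / 2)
    (hpert : Real.exp (1 / 4) * ((ρ𝒦 + u₁) * Real.exp (fieldWt h (L : ℝ) d 0 / (L : ℝ) ^ 0)) * A ≤ 1 / 2)
    -- the `h`-indexed system (abbreviations fixed by their defining equations)
    (Asys : (fun k => HamSpace ℂ d (fieldWt h (L : ℝ) d k) ((L : ℝ) ^ k) (L ^ (d * k))) 0 → (k : ℕ) → ((fun k => HamSpace ℂ d (fieldWt h (L : ℝ) d k) ((L : ℝ) ^ k) (L ^ (d * k))) k ≃L[ℝ] (fun k => HamSpace ℂ d (fieldWt h (L : ℝ) d k) ((L : ℝ) ^ k) (L ^ (d * k))) (k + 1)))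
    (hAsys : Asys = fun h₀ => rgA L h (fun jj => 𝒞 ((1 : Matrix (Fin d) (Fin d) ℝ) + hamTuningMap ρ h₀) jj))
    (Bsys : (fun k => HamSpace ℂ d (fieldWt h (L : ℝ) d k) ((L : ℝ) ^ k) (L ^ (d * k))) 0 → (k : ℕ) → ((fun k => activitySpace (abkmNormParams L N Mord R pT r₀ h θbar A (schedDelta δ₀ δ₁ N) fun j => 𝒞 1 j) k) k →+ (fun k => HamSpace ℂ d (fieldWt h (L : ℝ) d k) ((L : ℝ) ^ k) (L ^ (d * k))) (k + 1)))
    (hBsys : Eq Bsys fun h₀ =>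
      rgBT hd hMord hMR hLodd hL hM hθbar hlam hn hn2 hnñ hc hC1 hallA hB pT r₀ hr₀ A hθ0 hθ hT₀ hKT₀ (hamTuningMap ρ h₀))
    (Ssys : (fun k => HamSpace ℂ d (fieldWt h (L : ℝ) d k) ((L : ℝ) ^ k) (L ^ (d * k))) 0 → (k : ℕ) → (fun k => HamSpace ℂ d (fieldWt h (L : ℝ) d k) ((L : ℝ) ^ k) (L ^ (d * k))) k → (fun k => activitySpace (abkmNormParams L N Mord R pT r₀ h θbar A (schedDelta δ₀ δ₁ N) fun j => 𝒞 1 j) k) k → (fun k => activitySpace (abkmNormParams L N Mord R pT r₀ h θbar A (schedDelta δ₀ δ₁ N) fun j => 𝒞 1 j) k) (k + 1))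
    (hSsys : Ssys = fun h₀ =>
      rgSQ (L := L) (N := N) (Mord := Mord) (R := R) (p := pT) (r₀ := r₀) (h := h) (θbar := θbar) (A := A)
            (δ₀ := δ₀) (δ₁ := δ₁) (𝒞 := fun j => 𝒞 1 j) (fun jj => 𝒞 ((1 : Matrix (Fin d) (Fin d) ℝ) + hamTuningMap ρ h₀) jj))
    (Φ : (fun k => HamSpace ℂ d (fieldWt h (L : ℝ) d k) ((L : ℝ) ^ k) (L ^ (d * k))) 0 → (fun k => activitySpace (abkmNormParams L N Mord R pT r₀ h θbar A (schedDelta δ₀ δ₁ N) fun j => 𝒞 1 j) k) N → ℂ)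
    (hΦ : Φ = fun h₀ yN =>
      (∫ φ, ((yN : activitySpace (abkmNormParams L N Mord R pT r₀ h θbar A (schedDelta δ₀ δ₁ N) fun j => 𝒞 1 j) N) : Finset (Fin d → ZMod M) → ((Fin d → ZMod M) → ℝ) → ℂ) Finset.univ φ
            ∂(stepMeasure (𝒞 ((1 : Matrix (Fin d) (Fin d) ℝ) + hamTuningMap ρ h₀) (N + 1)))))
    -- the first-order `q`-regularity of the steps and of the last-scale functional (census F4)
    {a₀ b₀ l₀ lI : ℝ} (ha0 : 0 ≤ a₀) (hb0 : 0 ≤ b₀) (hl0 : 0 ≤ l₀) (hlI : 0 ≤ lI)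
    (ha : ∀ h₀ h₀' : HamSpace ℂ d (fieldWt h (L : ℝ) d 0) ((L : ℝ) ^ 0) (L ^ (d * 0)), ‖h₀‖ ≤ ρ → ‖h₀'‖ ≤ ρ → ∀ k, k < N →
      ∀ w : HamSpace ℂ d (fieldWt h (L : ℝ) d (k + 1)) ((L : ℝ) ^ (k + 1)) (L ^ (d * (k + 1))),
        ‖(Asys h₀ k).symm w - (Asys h₀' k).symm w‖ ≤ a₀ * ‖h₀ - h₀'‖ * ‖w‖)
    (hb : ∀ h₀ h₀' : HamSpace ℂ d (fieldWt h (L : ℝ) d 0) ((L : ℝ) ^ 0) (L ^ (d * 0)), ‖h₀‖ ≤ ρ → ‖h₀'‖ ≤ ρ → ∀ k, k < N →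
      ∀ (v : activitySpace (abkmNormParams L N Mord R pT r₀ h θbar A (schedDelta δ₀ δ₁ N) fun j => 𝒞 1 j) k) (cv : ℝ), activityNormLE (abkmNormParams L N Mord R pT r₀ h θbar A (schedDelta δ₀ δ₁ N) fun j => 𝒞 1 j) k v cv →
        ‖Bsys h₀ k v - Bsys h₀' k v‖ ≤ b₀ * ‖h₀ - h₀'‖ * cv)
    (hl : ∀ h₀ h₀' : HamSpace ℂ d (fieldWt h (L : ℝ) d 0) ((L : ℝ) ^ 0) (L ^ (d * 0)), ‖h₀‖ ≤ ρ → ‖h₀'‖ ≤ ρ → ∀ k, k < N →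
      ∀ (u : HamSpace ℂ d (fieldWt h (L : ℝ) d k) ((L : ℝ) ^ k) (L ^ (d * k))) (v : activitySpace (abkmNormParams L N Mord R pT r₀ h θbar A (schedDelta δ₀ δ₁ N) fun j => 𝒞 1 j) k) (cv : ℝ), ‖u‖ ≤ r → activityNormLE (abkmNormParams L N Mord R pT r₀ h θbar A (schedDelta δ₀ δ₁ N) fun j => 𝒞 1 j) k v cv → cv ≤ r →
        activityNormLE (abkmNormParams L N Mord R pT r₀ h θbar A (schedDelta δ₀ δ₁ N) fun j => 𝒞 1 j) (k + 1) (Ssys h₀ k u v - Ssys h₀' k u v) (l₀ * ‖h₀ - h₀'‖ * max ‖u‖ cv))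
    (hΦ2 : ∀ h₀ h₀' : HamSpace ℂ d (fieldWt h (L : ℝ) d 0) ((L : ℝ) ^ 0) (L ^ (d * 0)), ‖h₀‖ ≤ ρ → ‖h₀'‖ ≤ ρ → ∀ (yN : activitySpace (abkmNormParams L N Mord R pT r₀ h θbar A (schedDelta δ₀ δ₁ N) fun j => 𝒞 1 j) N) (cv : ℝ), activityNormLE (abkmNormParams L N Mord R pT r₀ h θbar A (schedDelta δ₀ δ₁ N) fun j => 𝒞 1 j) N yN cv → cv ≤ r →
      ‖Φ h₀ yN - Φ h₀' yN‖ ≤ lI * ‖h₀ - h₀'‖ * cv)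
    (hsmallF : max (16 * Real.exp (3 / 8) * (ρ𝒦 * Real.exp (fieldWt h (L : ℝ) d 0 / (L : ℝ) ^ 0)) * A) (max (l₀ * ε / η) ((3 / 4 * b₀ + a₀ * (η + ((L : ℝ) ^ d * (pi2BoundConst d (((2 * R + 2 : ℕ) : ℝ) + ((d / 2 + 1 : ℕ) : ℝ)) * (A𝒫' * A⁻¹))) + 2 * ρ * b₀)) * ε)) ≤ (1 - κ) / 2)
    -- two tuned seeds with their trajectories
    (x₁ x₂ : HamSpace ℂ d (fieldWt h (L : ℝ) d 0) ((L : ℝ) ^ 0) (L ^ (d * 0))) (xx₁ xx₂ : ∀ k, HamSpace ℂ d (fieldWt h (L : ℝ) d k) ((L : ℝ) ^ k) (L ^ (d * k)))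
    (htr₁ : RGFlow.IsTunedQ (E := (fun k => HamSpace ℂ d (fieldWt h (L : ℝ) d k) ((L : ℝ) ^ k) (L ^ (d * k)))) (F := (fun k => activitySpace (abkmNormParams L N Mord R pT r₀ h θbar A (schedDelta δ₀ δ₁ N) fun j => 𝒞 1 j) k)) N (Asys x₁) (Bsys x₁) (Ssys x₁)
      (initAct (N := N) (Mord := Mord) (R := R) (p := pT) (r₀ := r₀) (θbar := θbar) (A := A) (δ₀ := δ₀)
            (δ₁ := δ₁) (𝒞 := fun j => 𝒞 1 j) (fun w => 𝒦 w + U w) x₁) xx₁)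
    (htu₁ : RGFlow.InTubeQ (E := (fun k => HamSpace ℂ d (fieldWt h (L : ℝ) d k) ((L : ℝ) ^ k) (L ^ (d * k)))) (F := (fun k => activitySpace (abkmNormParams L N Mord R pT r₀ h θbar A (schedDelta δ₀ δ₁ N) fun j => 𝒞 1 j) k)) N η ε (activityNormLE (abkmNormParams L N Mord R pT r₀ h θbar A (schedDelta δ₀ δ₁ N) fun j => 𝒞 1 j)) (Ssys x₁)
      (initAct (N := N) (Mord := Mord) (R := R) (p := pT) (r₀ := r₀) (θbar := θbar) (A := A) (δ₀ := δ₀)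
            (δ₁ := δ₁) (𝒞 := fun j => 𝒞 1 j) (fun w => 𝒦 w + U w) x₁) xx₁)
    (hx₁ : xx₁ 0 = x₁)
    (htr₂ : RGFlow.IsTunedQ (E := (fun k => HamSpace ℂ d (fieldWt h (L : ℝ) d k) ((L : ℝ) ^ k) (L ^ (d * k)))) (F := (fun k => activitySpace (abkmNormParams L N Mord R pT r₀ h θbar A (schedDelta δ₀ δ₁ N) fun j => 𝒞 1 j) k)) N (Asys x₂) (Bsys x₂) (Ssys x₂)
      (initAct (N := N) (Mord := Mord) (R := R) (p := pT) (r₀ := r₀) (θbar := θbar) (A := A) (δ₀ := δ₀)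
            (δ₁ := δ₁) (𝒞 := fun j => 𝒞 1 j) 𝒦 x₂) xx₂)
    (htu₂ : RGFlow.InTubeQ (E := (fun k => HamSpace ℂ d (fieldWt h (L : ℝ) d k) ((L : ℝ) ^ k) (L ^ (d * k)))) (F := (fun k => activitySpace (abkmNormParams L N Mord R pT r₀ h θbar A (schedDelta δ₀ δ₁ N) fun j => 𝒞 1 j) k)) N η ε (activityNormLE (abkmNormParams L N Mord R pT r₀ h θbar A (schedDelta δ₀ δ₁ N) fun j => 𝒞 1 j)) (Ssys x₂)
      (initAct (N := N) (Mord := Mord) (R := R) (p := pT) (r₀ := r₀) (θbar := θbar) (A := A) (δ₀ := δ₀)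
            (δ₁ := δ₁) (𝒞 := fun j => 𝒞 1 j) 𝒦 x₂) xx₂)
    (hx₂ : xx₂ 0 = x₂)
    (hp4 : 4 * pT ≤ 2 ^ (d + 2))
    (hqε : 2 * (d : ℝ) ^ 2 / (((L ^ (d * 0) : ℕ) : ℝ) * (fieldWt h (L : ℝ) d 0 / (L : ℝ) ^ 0) ^ 2) * ε ≤ 1 / 2) :
    ‖(((((Real.log (formChangeConst (M := M) (1 : Matrix (Fin d) (Fin d) ℝ)
              (1 + hamQuadForm (HamSpace.toHam x₁)))) : ℝ) : ℂ)
          + (Fintype.card (Fin d → ZMod M) : ℂ) * (HamSpace.toHam x₁) (Sum.inl ())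
          + Complex.log (∫ φ, pcirc 1 (fun Y => expNegH (HamSpace.toHam x₁) Y φ)
            (fun X => initKH (fun w => 𝒦 w + U w) (HamSpace.toHam x₁) X φ) Finset.univ
          ∂(tailMeasure (fun jj => 𝒞 ((1 : Matrix (Fin d) (Fin d) ℝ) + hamQuadForm (HamSpace.toHam x₁)) jj) N N))))
      - (((((Real.log (formChangeConst (M := M) (1 : Matrix (Fin d) (Fin d) ℝ)
              (1 + hamQuadForm (HamSpace.toHam x₂)))) : ℝ) : ℂ)
          + (Fintype.card (Fin d → ZMod M) : ℂ) * (HamSpace.toHam x₂) (Sum.inl ())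
          + Complex.log (∫ φ, pcirc 1 (fun Y => expNegH (HamSpace.toHam x₂) Y φ)
            (fun X => initKH 𝒦 (HamSpace.toHam x₂) X φ) Finset.univ
          ∂(tailMeasure (fun jj => 𝒞 ((1 : Matrix (Fin d) (Fin d) ℝ) + hamQuadForm (HamSpace.toHam x₂)) jj) N N))))‖
    ≤ ((2 * (d : ℝ) ^ 2 / (((L ^ (d * 0) : ℕ) : ℝ) * (fieldWt h (L : ℝ) d 0 / (L : ℝ) ^ 0) ^ 2)) * (2 * (Real.exp (1 / 4) * Real.exp (fieldWt h (L : ℝ) d 0 / (L : ℝ) ^ 0) * A) / (1 - κ)) + (2 * (Real.exp (1 / 4) * Real.exp (fieldWt h (L : ℝ) d 0 / (L : ℝ) ^ 0) * A) / (1 - κ)) + ((A⁻¹ * A𝒫') + lI * ε) * (2 * (Real.exp (1 / 4) * Real.exp (fieldWt h (L : ℝ) d 0 / (L : ℝ) ^ 0) * A) / (1 - κ)) / (1 - ε))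
      * (Fintype.card (Fin d → ZMod M) : ℝ) * u₁ := by
  have hh : 0 < h := Fact.out
  have hA : 0 < A := by linarith
  have hρ0 : 0 ≤ ρ := hε.trans hερ
  have h1κ : 0 < 1 - κ := by linarith
  have hA𝒫0 : 0 ≤ A𝒫' := by
    rw [← hA𝒫']
    exact zero_le_one.trans (one_le_weightIntConstRho hθbar hθ0 hθ
      (traceConst_nonneg d Mord R hlam.le (derivSum_nonneg d n _)))
  have hE : 0 < Real.exp (fieldWt h (L : ℝ) d 0 / (L : ℝ) ^ 0) := Real.exp_pos _
  -- the two sizes, rewritten as `T = c u₁`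
  obtain ⟨hdT, hDB⟩ := freeEnergySubSizes_of_package hd hMord hMR hLodd hL hR2 hM hθbar hlam hn hn2 hnñ hc hC1 hallA hB hp hpM hr₀ hδ₀ hδ₁ hh0 hh2
    hθ0 hθ hT₀ hKT₀ hA𝒫' hA1 hA𝒫A hsmall hr0 hr hv hωA hc3A hc2A hη hη1 hκ₁ hκ₂ hκ hε hεr hερ hρ16 hqT₀ h𝒦 hU h𝒦b h𝒦Ub
    hUb hu₁ h𝒦small hpert Asys hAsys Bsys hBsys Ssys hSsys Φ hΦ ha0 hb0 hl0 hlI ha hb hl hΦ2 hsmallF x₁ x₂ xx₁ xx₂ htr₁ htu₁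
    hx₁ htr₂ htu₂ hx₂
  have hdT' : ‖x₁ - x₂‖ ≤ (2 * (Real.exp (1 / 4) * Real.exp (fieldWt h (L : ℝ) d 0 / (L : ℝ) ^ 0) * A) / (1 - κ)) * u₁ := hdT.trans (le_of_eq (by ring))
  have hDB' : ‖Φ x₁ (RGFlow.fwd (Ssys x₁) (initAct (N := N) (Mord := Mord) (R := R) (p := pT) (r₀ := r₀) (θbar := θbar) (A := A) (δ₀ := δ₀)
            (δ₁ := δ₁) (𝒞 := fun j => 𝒞 1 j) (fun w => 𝒦 w + U w) x₁) xx₁ N)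
        - Φ x₂ (RGFlow.fwd (Ssys x₂) (initAct (N := N) (Mord := Mord) (R := R) (p := pT) (r₀ := r₀) (θbar := θbar) (A := A) (δ₀ := δ₀)
            (δ₁ := δ₁) (𝒞 := fun j => 𝒞 1 j) 𝒦 x₂) xx₂ N)‖
          ≤ ((A⁻¹ * A𝒫') + lI * ε) * ((2 * (Real.exp (1 / 4) * Real.exp (fieldWt h (L : ℝ) d 0 / (L : ℝ) ^ 0) * A) / (1 - κ)) * u₁) * η ^ N := hDB.trans (le_of_eq (by ring))
  -- the clause from the sizes
  have hmain := norm_freeEnergy_sub_le_of_sizes hd hMord hMR hLodd hL hR2 hM hθbar hlam hn hn2 hnñ hc hC1 hallA hB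
    hp hpM hr₀ hδ₀ hδ₁ hh0 hh2 hθ0 hθ hT₀ hKT₀ hA𝒫' hA1 hA𝒫A hsmall hr hv hωA hc3A hc2A hη hη1 hε hεr hερ hρ16 hp4
    hqT₀ hqε (h𝒦.add hU) h𝒦 h𝒦Ub h𝒦b h𝒦small Asys hAsys Bsys hBsys Ssys hSsys Φ hΦ x₁ x₂ xx₁ xx₂ htr₁ htu₁ hx₁ htr₂ htu₂
    hx₂ hdT' hDB'
  have hV1 : (1 : ℝ) ≤ (Fintype.card (Fin d → ZMod M) : ℝ) := by exact_mod_cast Fintype.card_pos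
  have hcc0 : 0 ≤ (2 * (Real.exp (1 / 4) * Real.exp (fieldWt h (L : ℝ) d 0 / (L : ℝ) ^ 0) * A) / (1 - κ)) := by positivity
  have h0AA : 0 ≤ A⁻¹ * A𝒫' := mul_nonneg (inv_pos.2 hA).le hA𝒫0
  have hε1 : ε < 1 := by linarith
  have hR₀ε : ε * η ^ N * A⁻¹ * A𝒫' ≤ ε := by
    have hηN : η ^ N ≤ 1 := pow_le_one₀ hη.le hη1
    have hAA : A⁻¹ * A𝒫' ≤ 1 := by rw [inv_mul_le_iff₀ hA]; linarith
    calc ε * η ^ N * A⁻¹ * A𝒫' = ε * (η ^ N * (A⁻¹ * A𝒫')) := by ring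
      _ ≤ ε * (1 * 1) := by gcongr
      _ = ε := by ring
  exact hmain.trans (RGFlow.freeEnergy_sub_bound_le (cq := (2 * (d : ℝ) ^ 2 / (((L ^ (d * 0) : ℕ) : ℝ) * (fieldWt h (L : ℝ) d 0 / (L : ℝ) ^ 0) ^ 2))) hV1 hcc0 h0AA hlI hu₁ hε hR₀ε hε1 hη.le hη1)

end Package

end Summit.HubbardSuperconductivity.HubbardSuperconductivity.Theorems.ComplexGFF

end
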